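import Summits.Ventures.QEC.CircuitDistance.ETowerZeroCert
import HarnessLib

/-!
# P3-PORT STEP 2 (E-fold tower): BANDED zero-fibre certificates — add-on to `ETowerZeroCert` (§B10; ZERO-CERT §1)
(cell `qec`, experiment CDX, seat qec-cdx-idea-1 g5; consumer of record = type-1 g2 `ETowerZeroCert.zeroD_of_zcert`, p694091)

`zeroD_of_zcert` consumes, per block `b` and per number `k < h` of further slots, ONE Bool fact `zl k M ok (M a) (2^a) (a+1) ns
= true` — one `decide +kernel` over `C(ns − a − 1, k)` leaves.  For the #345 tower (`W = 10`, `h = 5`) the level-B item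
`(b, k) = (0, 4)` alone is `C(89,4) = 2 441 626` leaves, too heavy for one theorem.  This module splits such an item ACROSS
THEOREMS by the OUTER slot:

* `zbandk M ok t acc lo ilo ihi` (k = 1 … 4) = the `zloopk` nest with its outermost slot restricted to `i ∈ [ilo, ihi)` (inner
  slots over `[lo, i)` as before) — the same `List.range / List.all` text shape;
* `bandCover lo n B` = the bands `B : List (ℕ × ℕ)` cover every outer slot `i ∈ [lo, n)` (a small `decide`);
* `zbandK_ZT` : a passing band gives the semantic inner nests `ZT M ok (k−1) (0 ⊕ M i) t (acc ||| 2^i) lo i` for its slots,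
  `ZT_of_bands` : covering bands give `ZT M ok k 0 t acc lo n` — exactly what `zl_ZT` gives for a whole item;
* ★ `zeroD_of_ZT` = `zeroD_of_zcert` with the hypothesis `hz` stated on the semantic nests (proof text verbatim otherwise), so
  whole items (`zl_ZT zc…`) and banded items (`ZT_of_bands cov… …`) mix freely.

Generic; no data; no `native_decide`.  Nothing here asserts a value of `d_circ`.
-/

set_option maxRecDepth 100000
set_option linter.unusedVariables false

namespace Summit.Ventures.QEC.CircuitDistance.ETower

open Summit.Ventures.QEC.Census Summit.Ventures.QEC.Census.Fold

/-! ## The banded Bool nests (outer slot restricted to `[ilo, ihi)`) -/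

/-- band of the 1-slot nest: `∀ i ∈ [ilo, ihi), M i = t → ok (acc ||| 2^i)` (`lo` unused: the band bounds replace it). -/
def zband1 (M : ℕ → ℕ) (ok : ℕ → Bool) (t acc _lo ilo ihi : ℕ) : Bool :=
  (List.range ihi).all fun i => !(ilo ≤ i) || (M i != t) || ok (acc ||| 2 ^ i)
/-- band of the 2-slot nest: outer `i ∈ [ilo, ihi)`, inner `j ∈ [lo, i)`. -/
def zband2 (M : ℕ → ℕ) (ok : ℕ → Bool) (t acc lo ilo ihi : ℕ) : Bool :=
  (List.range ihi).all fun i => !(ilo ≤ i) || (List.range i).all fun j => !(lo ≤ j) || (M i ^^^ M j != t) || ok (acc ||| 2 ^ i ||| 2 ^ j)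
/-- band of the 3-slot nest. -/
def zband3 (M : ℕ → ℕ) (ok : ℕ → Bool) (t acc lo ilo ihi : ℕ) : Bool :=
  (List.range ihi).all fun i => !(ilo ≤ i) || (List.range i).all fun j => !(lo ≤ j) ||
    (List.range j).all fun k => !(lo ≤ k) || (M i ^^^ M j ^^^ M k != t) || ok (acc ||| 2 ^ i ||| 2 ^ j ||| 2 ^ k)
/-- band of the 4-slot nest. -/
def zband4 (M : ℕ → ℕ) (ok : ℕ → Bool) (t acc lo ilo ihi : ℕ) : Bool :=
  (List.range ihi).all fun i => !(ilo ≤ i) || (List.range i).all fun j => !(lo ≤ j) ||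
    (List.range j).all fun k => !(lo ≤ k) || (List.range k).all fun l => !(lo ≤ l) ||
      (M i ^^^ M j ^^^ M k ^^^ M l != t) || ok (acc ||| 2 ^ i ||| 2 ^ j ||| 2 ^ k ||| 2 ^ l)

/-- The `k`-slot banded nest (`1 ≤ k ≤ 4`; `false` otherwise). -/
def zbandK (k : ℕ) (M : ℕ → ℕ) (ok : ℕ → Bool) (t acc lo ilo ihi : ℕ) : Bool :=
  match k with
  | 1 => zband1 M ok t acc lo ilo ihi
  | 2 => zband2 M ok t acc lo ilo ihi
  | 3 => zband3 M ok t acc lo ilo ihi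
  | 4 => zband4 M ok t acc lo ilo ihi
  | _ => false

/-- The bands `B` (pairs `(ilo, ihi)`) cover every outer slot `i ∈ [lo, n)`. -/
def bandCover (lo n : ℕ) (B : List (ℕ × ℕ)) : Bool :=
  (List.range n).all fun i => !(lo ≤ i) || B.any fun p => p.1 ≤ i && i < p.2

/-! ## Bands ⇒ semantic nests -/

section Bridge

variable {M : ℕ → ℕ} {ok : ℕ → Bool} {t acc lo ilo ihi : ℕ}

/-- one guard level of the Bool nest (as in `ETowerZeroCert`, where it is private). -/
theorem bguard_of_all {f : ℕ → Bool} {n lo i : ℕ} (h : ((List.range n).all fun i => !(lo ≤ i) || f i) = true)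
    (hlo : lo ≤ i) (hi : i < n) : f i = true := by
  have := List.all_eq_true.1 h i (List.mem_range.2 hi)
  rw [Bool.or_eq_true] at this
  rcases this with h' | h'
  · rw [Bool.not_eq_true', decide_eq_false_iff_not] at h'; exact absurd hlo h'
  · exact h'

/-- the leaf test of the Bool nest (as in `ETowerZeroCert`, where it is private). -/
theorem bleaf_of_or {x t : ℕ} {b : Bool} (h : ((x != t) || b) = true) (hx : x = t) : b = true := by
  rw [Bool.or_eq_true] at h
  rcases h with h' | h'
  · rw [bne_iff_ne] at h'; exact absurd hx h'
  · exact h'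

/-- `zband1` ⇒ the 0-nests of its slots. -/
theorem zband1_ZT (h : zband1 M ok t acc lo ilo ihi = true) :
    ∀ i, ilo ≤ i → i < ihi → ZT M ok 0 (0 ^^^ M i) t (acc ||| 2 ^ i) lo i := by
  intro i hilo hi hp
  unfold zband1 at h
  have h1 := bguard_of_all (f := fun i => (M i != t) || ok (acc ||| 2 ^ i)) (by simpa only [Bool.or_assoc] using h) hilo hi
  rw [Nat.zero_xor] at hp
  exact bleaf_of_or h1 hp

/-- `zband2` ⇒ the 1-nests of its slots. -/
theorem zband2_ZT (h : zband2 M ok t acc lo ilo ihi = true) :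
    ∀ i, ilo ≤ i → i < ihi → ZT M ok 1 (0 ^^^ M i) t (acc ||| 2 ^ i) lo i := by
  intro i hilo hi j hloj hj hp
  unfold zband2 at h
  have h1 := bguard_of_all h hilo hi
  have h2 := bguard_of_all (f := fun j => (M i ^^^ M j != t) || ok (acc ||| 2 ^ i ||| 2 ^ j))
    (by simpa only [Bool.or_assoc] using h1) hloj hj
  rw [Nat.zero_xor] at hp
  exact bleaf_of_or h2 hp

/-- `zband3` ⇒ the 2-nests of its slots. -/
theorem zband3_ZT (h : zband3 M ok t acc lo ilo ihi = true) :
    ∀ i, ilo ≤ i → i < ihi → ZT M ok 2 (0 ^^^ M i) t (acc ||| 2 ^ i) lo i := by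
  intro i hilo hi j hloj hj k hlok hk hp
  unfold zband3 at h
  have h1 := bguard_of_all h hilo hi
  have h2 := bguard_of_all h1 hloj hj
  have h3 := bguard_of_all (f := fun k => (M i ^^^ M j ^^^ M k != t) || ok (acc ||| 2 ^ i ||| 2 ^ j ||| 2 ^ k))
    (by simpa only [Bool.or_assoc] using h2) hlok hk
  rw [Nat.zero_xor] at hp
  exact bleaf_of_or h3 hp

/-- `zband4` ⇒ the 3-nests of its slots. -/
theorem zband4_ZT (h : zband4 M ok t acc lo ilo ihi = true) :
    ∀ i, ilo ≤ i → i < ihi → ZT M ok 3 (0 ^^^ M i) t (acc ||| 2 ^ i) lo i := by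
  intro i hilo hi j hloj hj k hlok hk l hlol hl hp
  unfold zband4 at h
  have h1 := bguard_of_all h hilo hi
  have h2 := bguard_of_all h1 hloj hj
  have h3 := bguard_of_all h2 hlok hk
  have h4 := bguard_of_all (f := fun l => (M i ^^^ M j ^^^ M k ^^^ M l != t) || ok (acc ||| 2 ^ i ||| 2 ^ j ||| 2 ^ k ||| 2 ^ l))
    (by simpa only [Bool.or_assoc] using h3) hlol hl
  rw [Nat.zero_xor] at hp
  exact bleaf_of_or h4 hp

/-- `zbandK (k+1)` ⇒ the `k`-nests of its slots. -/
theorem zbandK_ZT {k : ℕ} (h : zbandK (k + 1) M ok t acc lo ilo ihi = true) :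
    ∀ i, ilo ≤ i → i < ihi → ZT M ok k (0 ^^^ M i) t (acc ||| 2 ^ i) lo i := by
  match k, h with
  | 0, h => exact zband1_ZT h
  | 1, h => exact zband2_ZT h
  | 2, h => exact zband3_ZT h
  | 3, h => exact zband4_ZT h
  | _ + 4, h => exact absurd h (by simp [zbandK])

/-- ★ **COVERING BANDS give the whole nest**: if the bands `B` cover `[lo, n)` and each passes at level `k+1`, then
`ZT M ok (k+1) 0 t acc lo n` — the statement `zl_ZT` gives for the unbanded fact. -/
theorem ZT_of_bands {k n : ℕ} {B : List (ℕ × ℕ)} (hcov : bandCover lo n B = true)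
    (hB : ∀ q ∈ B, zbandK (k + 1) M ok t acc lo q.1 q.2 = true) : ZT M ok (k + 1) 0 t acc lo n := by
  intro i hlo hi
  have hc := bguard_of_all (f := fun i => B.any fun p => p.1 ≤ i && i < p.2) hcov hlo hi
  obtain ⟨q, hq, hqi⟩ := List.any_eq_true.1 hc
  rw [Bool.and_eq_true, decide_eq_true_eq, decide_eq_true_eq] at hqi
  exact zbandK_ZT (hB q hq) i hqi.1 hqi.2

end Bridge

/-! ## A fast matcher: least translate ∈ list (lists in least-translate normal form) -/

/-- the least numeral among the translates of `c` (its orbit representative). -/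
def orbMin (l m nb : ℕ) (c : ℕ) : ℕ :=
  ((List.range l).flatMap fun da => (List.range m).map fun db => transWK l m nb da db c).foldl min (transWK l m nb 0 0 c)

/-- FAST MATCHER: the least translate of `c` is literally listed.  Sound for ANY list (`matchedK_of_matchedM`); it finds every
match when the list holds least translates (the emitter's normal form).  Cost = `l·m` translations + one membership scan,
versus `|D|·l·m` translations for `matchedB`. -/
def matchedM (l m nb : ℕ) (D : List ℕ) (c : ℕ) : Bool := D.elem (orbMin l m nb c)

/-- `List.foldl min a L` is either the seed `a` or a member of `L`. -/
theorem foldl_min_mem (L : List ℕ) : ∀ a : ℕ, L.foldl min a = a ∨ L.foldl min a ∈ L := by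
  induction L with
  | nil => intro a; exact Or.inl rfl
  | cons x L ih =>
    intro a
    rw [List.foldl_cons]
    rcases ih (min a x) with h | h
    · rw [h]
      rcases Nat.le_total a x with hax | hxa
      · exact Or.inl (Nat.min_eq_left hax)
      · exact Or.inr (by rw [Nat.min_eq_right hxa]; exact List.mem_cons_self ..)
    · exact Or.inr (List.mem_cons_of_mem _ h)

/-- the least translate is a translate. -/
theorem orbMin_spec (l m nb c : ℕ) : ∃ da db, orbMin l m nb c = transWK l m nb da db c := by
  unfold orbMin
  rcases foldl_min_mem _ (transWK l m nb 0 0 c) with h | h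
  · exact ⟨0, 0, h⟩
  · obtain ⟨da, -, h⟩ := List.mem_flatMap.1 h
    obtain ⟨db, -, h⟩ := List.mem_map.1 h
    exact ⟨da, db, h.symm⟩

/-- `matchedM` certifies `MatchedK`. -/
theorem matchedK_of_matchedM {l m nb : ℕ} {D : List ℕ} {c : ℕ} (h : matchedM l m nb D c = true) : MatchedK l m nb D c := by
  unfold matchedM at h
  obtain ⟨da, db, e⟩ := orbMin_spec l m nb c
  exact ⟨_, List.elem_iff.1 h, da, db, e.symm⟩

/-- BUCKETED MEMBERSHIP (for long lists): the reps are stored in `P × P` buckets keyed by `(v % P, v / P % P)`; the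
list a statement speaks about is `B.flatten.flatten`. -/
def bucketOf (P : ℕ) (B : List (List (List ℕ))) (v : ℕ) : List ℕ := (B.getD (v % P) []).getD (v / P % P) []

/-- FAST MATCHER, bucketed: the least translate of `c` lies in its bucket.  Sound for ANY bucket table (`matchedK_of_matchedH`). -/
def matchedH (l m nb P : ℕ) (B : List (List (List ℕ))) (c : ℕ) : Bool :=
  (bucketOf P B (orbMin l m nb c)).elem (orbMin l m nb c)

/-- A member of `L.getD i []` lies in some member of `L`. -/
theorem exists_mem_of_mem_getD {α : Type} {L : List (List α)} {i : ℕ} {x : α} (h : x ∈ L.getD i []) : ∃ l ∈ L, x ∈ l := by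
  rw [List.getD_eq_getElem?_getD] at h
  cases hi : L[i]? with
  | none => rw [hi] at h; simp at h
  | some l => rw [hi, Option.getD_some] at h; exact ⟨l, List.mem_of_getElem? hi, h⟩

/-- A member of a bucket `bucketOf P B v` lies in `B.flatten.flatten`. -/
theorem mem_flatten_of_mem_bucketOf {P : ℕ} {B : List (List (List ℕ))} {v x : ℕ} (h : x ∈ bucketOf P B v) :
    x ∈ B.flatten.flatten := by
  obtain ⟨bucket, hb, hx⟩ := exists_mem_of_mem_getD (L := B.getD (v % P) []) h
  obtain ⟨row, hr, hb'⟩ := exists_mem_of_mem_getD (L := B) hb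
  exact List.mem_flatten.2 ⟨bucket, List.mem_flatten.2 ⟨row, hr, hb'⟩, hx⟩

/-- `matchedH` certifies `MatchedK` for the flattened bucket table. -/
theorem matchedK_of_matchedH {l m nb P : ℕ} {B : List (List (List ℕ))} {c : ℕ} (h : matchedH l m nb P B c = true) :
    MatchedK l m nb B.flatten.flatten c := by
  unfold matchedH at h
  obtain ⟨da, db, e⟩ := orbMin_spec l m nb c
  exact ⟨_, mem_flatten_of_mem_bucketOf (List.elem_iff.1 h), da, db, e.symm⟩

/-! ## The consumers on semantic nests (any sound matcher `ok`) -/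

/-- ★ **LOW-WEIGHT KERNEL COMPLETENESS OF A PLAIN TABLE from the semantic nests.**  For a column table `M` on the `nb`-block
torus `(l, m)` whose kernel is translation-invariant (`hKM`) and a matcher `ok` sound for `MatchedK … D`: if for every block `b`
(anchor `a = b·l·m`) and every `k < h` the nest `ZT M ok k 0 (M a) (2^a) (a+1) n` holds, then every kernel word of weight `≤ h` is
`0` or matched in `D`.  (MIN-BLOCK ANCHORING `anchor_exists` + `ZT_sound`, as in `zeroD_of_zcert`, without the doubling step.) -/
theorem kerD_of_ZT {l m nb : ℕ} (hl : 0 < l) (hm : 0 < m) {M : ℕ → ℕ}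
    (hKM : ∀ da db u, u < 2 ^ (nb * (l * m)) → lin M (nb * (l * m)) 0 u = 0 →
      lin M (nb * (l * m)) 0 (transWK l m nb da db u) = 0)
    {h : ℕ} {D : List ℕ} {ok : ℕ → Bool} (hok : ∀ c, ok c = true → MatchedK l m nb D c)
    (hz : ∀ b, b < nb → ∀ k, k < h →
      ZT M ok k 0 (M (b * (l * m))) (2 ^ (b * (l * m))) (b * (l * m) + 1) (nb * (l * m))) :
    ∀ c, c < 2 ^ (nb * (l * m)) → popc (nb * (l * m)) c ≤ h → lin M (nb * (l * m)) 0 c = 0 →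
      c = 0 ∨ MatchedK l m nb D c := by
  intro c hc hw hker
  rcases eq_or_ne c 0 with h0 | hne
  · exact Or.inl h0
  right
  -- anchor a translate
  obtain ⟨da, db, b, hb, hbit, hmin⟩ := anchor_exists hl hm hne hc
  set c' := transWK l m nb da db c with hc'def
  have hc'lt : c' < 2 ^ (nb * (l * m)) := transWK_lt hl hm nb da db c
  have hpc : popc (nb * (l * m)) c' ≤ h := by
    rw [hc'def, popc_transWK hl hm]; exact hw
  -- its syndrome vanishes
  have hkerM : lin M (nb * (l * m)) 0 c' = 0 := hKM da db c hc hker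
  -- remove the anchor bit
  have hA : b * (l * m) < nb * (l * m) := by
    by_contra hh
    rw [Nat.testBit_lt_two_pow (lt_of_lt_of_le hc'lt (Nat.pow_le_pow_right (by norm_num) (not_lt.1 hh)))] at hbit
    exact Bool.false_ne_true hbit
  obtain ⟨hor, hbits, hbi, hpc', hlinsplit⟩ := split_bit hbit hA
  have helt : c' ^^^ 2 ^ (b * (l * m)) < 2 ^ (nb * (l * m)) := by
    apply Nat.lt_pow_two_of_testBit
    intro j hj
    cases hj' : (c' ^^^ 2 ^ (b * (l * m))).testBit j
    · rfl
    · have := (hbits j hj').1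
      rw [Nat.testBit_lt_two_pow (lt_of_lt_of_le hc'lt (Nat.pow_le_pow_right (by norm_num) hj))] at this
      exact absurd this Bool.false_ne_true
  have hlo : ∀ i, (c' ^^^ 2 ^ (b * (l * m))).testBit i = true → b * (l * m) + 1 ≤ i := by
    intro i hi
    obtain ⟨hci, hne'⟩ := hbits i hi
    have := hmin i hci
    omega
  have hke : popc (nb * (l * m)) (c' ^^^ 2 ^ (b * (l * m))) < h := by omega
  have hlin : 0 ^^^ lin M (nb * (l * m)) 0 (c' ^^^ 2 ^ (b * (l * m))) = M (b * (l * m)) := by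
    rw [Nat.zero_xor]
    rw [hlinsplit M] at hkerM
    have := congrArg (· ^^^ M (b * (l * m))) hkerM
    simpa [Nat.xor_assoc] using this
  -- run the nest
  have hok' := ZT_sound _ _ _ _ _ _ (hz b hb _ hke) _ helt hlo rfl hlin
  have hc'eq : 2 ^ (b * (l * m)) ||| (c' ^^^ 2 ^ (b * (l * m))) = c' := by
    have := hor 0; rwa [Nat.zero_or, Nat.zero_or] at this
  rw [hc'eq] at hok'
  exact matchedK_of_matchedK_transWK hl hm (hok _ hok')

/-- ★ **ZERO-FIBRE D-LIST COMPLETENESS FROM THE SEMANTIC NESTS** — the hypothesis `hD` of `goodFibK_zero`, as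
`ETowerZeroCert.zeroD_of_zcert`, but (i) from the semantic nests `ZT M ok k 0 (M a) (2^a) (a+1) ns` (whole items by `zl_ZT`,
banded ones by `ZT_of_bands`) and (ii) for ANY matcher `ok` sound for `MatchedK` (`matchedK_of_matchedB`, `matchedK_of_matchedM`).
The fibre-table kernel is translation-invariant because doubling commutes with translation (`doubleK_transWK`, `kerK_doubleK_iff`). -/
theorem zeroD_of_ZT {G : Geo} {nb : ℕ} (hS : G.Shape) (hG : OKK G nb) {col M : ℕ → ℕ}
    (hM : ∀ j, j < nsK G nb → M j = col (G.emb j) ^^^ col (G.partner (G.emb j)))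
    (hK : ∀ da db u, u < 2 ^ nK G nb → (kerK col (nK G nb) u ↔ kerK col (nK G nb) (transWK G.l G.m nb da db u)))
    {W h : ℕ} (hWh : W < 2 * (h + 1)) {D : List ℕ} {ok : ℕ → Bool} (hok : ∀ c, ok c = true → MatchedK G.ls G.ms nb D c)
    (hz : ∀ b, b < nb → ∀ k, k < h →
      ZT M ok k 0 (M (b * (G.ls * G.ms))) (2 ^ (b * (G.ls * G.ms))) (b * (G.ls * G.ms) + 1) (nsK G nb)) :
    ∀ c, c < 2 ^ nsK G nb → 2 * popc (nsK G nb) c ≤ W → kerK col (nK G nb) (doubleK G nb c) →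
      c = 0 ∨ MatchedK G.ls G.ms nb D c := by
  intro c hc hw hker
  have hns : nsK G nb = nb * (G.ls * G.ms) := rfl
  rw [hns] at hc hw hz
  have hkM : ∀ u, kerK col (nK G nb) (doubleK G nb u) ↔ lin M (nb * (G.ls * G.ms)) 0 u = 0 :=
    fun u => kerK_doubleK_iff hG hM u
  refine kerD_of_ZT hS.ls_pos hS.ms_pos (M := M) ?_ hok hz c hc (by omega) ((hkM c).1 hker)
  intro da db u _ hMu
  have h1 : kerK col (nK G nb) (doubleK G nb u) := (hkM u).2 hMu
  have h2 : kerK col (nK G nb) (doubleK G nb (transWK G.ls G.ms nb da db u)) := by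
    rw [← doubleK_transWK hS hG]; exact (hK da db _ (doubleK_lt hG u)).1 h1
  exact (hkM _).1 h2

end Summit.Ventures.QEC.CircuitDistance.ETower
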